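import Literature.MathematicalPhysics.QuantumFieldTheory.BalabanImbrieJaffe1984to88.BIJ88Eq5127GaugeSector
import Literature.MathematicalPhysics.QuantumFieldTheory.BalabanImbrieJaffe1984to88.BIJ88FreeCoordinates48
import Literature.MathematicalPhysics.QuantumFieldTheory.BalabanImbrieJaffe1984to88.BIJ88ContourSupport536
import Literature.MathematicalPhysics.QuantumFieldTheory.BalabanImbrieJaffe1984to88.BIJ88Eq5128Locality

/-!
# `BalabanImbrieJaffe1984to88.BIJ88InteriorChartLaw` — T. Bałaban, J. Imbrie, A. Jaffe, *Effective action and cluster properties of the abelian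
Higgs model*, Commun. Math. Phys. **114** (1988) 257–315 [BalabanImbrieJaffe1988], Sect. 5.12 **(5.12.3)–(5.12.4)** p. 301 [PDF 45], **(5.12.7)**
p. 302, **(5.12.8)** p. 303 with **(4.6)–(4.8)** p. 275: **THE CHART LAW OF THE TRANSLATED INTERIOR GAUGE VARIABLES ON THE TORUS — the
hypothesis `HChart` of this seat's `BIJ88Eq5127GaugeSector` DISCHARGED for the measure `𝒟u δ_{Ax}`, and ROW C2.Eq5.12.8 (gauge half of
G-C2-23) WITH NO MEASURE-LEVEL HYPOTHESIS LEFT.**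

statement-level skeleton of published theorems with citation tags; proofs where landed; nothing here is a claim about the Yang–Mills mass gap

THE PRINT (verbatim, p. 301; read this session as the image `lit-balaban-p02/pages/original-p045-x2.png`).  *"The 4-th and 5-th forms, with
Z_{Λ^{c*c}_{10}}, are a calculation of ∫dA|_{Λ^{c*c}_{10}} δ_{Ax,Λ′_{10}}(A) δ_{Λ′^{c*c}_{10}}(QA) (e_k/2π)^{‖Λ^{c*c}_{10}‖} exp[−½⟨Λ^{c*c}_{10}A,
∂*σ_{k,loc}∂(Λ^{c*c}_{10} + 2Λ^{c*}_{10})A⟩]. (5.12.3) The factors e_k/2π come from the replacement of du^{(k)} with dA^{(k)} for the free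
variables; for the constrained variables the replacement is compensated by a removal of the e_k/2π factor from the δ-functions, see
(4.6)–(4.8). We calculate (5.12.3) by means of a translation A^{(k)} = A^{(k)′} − Λ^{c*c}_{10}Q^{s*}QΛ^{c*}_{10}A^{(k)}, (5.12.4)"*.

THE ASSEMBLY.  For one term `t` (interior `D t : Interior`, cut-off `Λ t`) and one exterior configuration `e`, the torus objects instantiate
the abstract system of this seat's `BIJ88FreeCoordinates48.chartLaw_canonical`: interior bonds `ι = Λ^{c*c}_{10}` with tree bonds
`Z = BIJ88InteriorHaarChart.InteriorChart.treeSet` (`μIU axialLaw = Π_b bondLaw_b`), constrained block bonds `γ = cset` (cut-off block bonds with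
an interior surface bond), surface assignment `σt` (r18's `IsCross`/`coarse`), block averages `qt e u = (Q u_e(u))|_γ` (r18's `qU` of the glued
field); then `transl σt (qt e) = u′_{cut-off}(u_e(·))|_{interior}` IS `BIJ88Eq5127GaugeSector.yInt` (`transl_eq_uCut`), the covariance `hcov` is r18's
`qU_surfMul` for the glued field (`qt_act`, fat-interior compatibility), `QQ^{s*} = 1` is `BIJ88ContourSupport536.mul_combAvg_sfA` (`Qm_sA`),
and the EXACT LINEARIZATION `hlin`/`hbd` on `|A_b| ≤ r + ε` is p31's `qU_phaseField` made local (`BIJ88ContourSupport536.qU_phaseField_near`),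
with `Q_{in} = Qm` (`L·`full contour average of the interior field), `θ = θOf(aOut e)` (the exterior part, read through the TRANSLATED exterior
variables of `BIJ88Eq5127GaugeSector.aOut` — equal to the untranslated ones on the bonds that matter, `uCut_gl_of_near`), `E = Et` the basis
matrix of the space of free integrations, `R = Rtt = Q^{s*}Q_{out}` (`Rt_mulVec`), `c_t = (e_k/2π)^{‖Λ_t‖}·J_t`.

WHAT IS PROVED (0 `sorry`; no `Prop`-valued fact; standard axioms).
 §1 the torus data and its dictionary with the abstract file (`cset`, `σt`, `gl`, `qt`, `transl_eq_uCut`, `σt_eq_none_of_mem_treeSet`, `gl_act`,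
    **`qt_act`** — covariance).
 §2 the Lie-algebra data (`ΘinL`, `ΘexL`, `Qm`, `θOf`, `Rmat`, `Smat`, `Rt`, `Rt_mulVec`), **`Qm_sA`** (`QQ^{s*} = 1`), `gl_expU1_eq_phaseField`,
    **`qt_expU1`** (the exact linearization near `Λ₁₀` with the bound `|e_k(Q_{in}A + θ)| < π`).
 §3 **`hChart`**: `HChart Λ D e_k Et Rtt ct r axialLaw t e` for EVERY exterior configuration `e` with `|(ie_k)⁻¹log e_b| ≤ r + ε` on the exterior
    bonds near the constrained block bonds of `Λ_t` — hypotheses: standing range, `e_k > 0`, `r ≥ 0`, `ε > 0`, `2(d+1)L·e_k(r + ε) < π`, and the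
    FAT-INTERIOR COMPATIBILITY `hfat` (every surface bond of a cut-off block bond having one interior surface bond is interior; p. 266 *"X^{c*c}
    includes bonds with one or both endpoints in X"*).
 §4 **`eq5128_gauge_of_support`** (G1's `eq5128_gauge` with `HChart` required only where `X₀ ≠ 0`: the renormalization congruence is trivial
    where the exterior bracket vanishes) and **`eq5128_gauge_torus`**: ROW C2.Eq5.12.8 on the torus for `𝒟u δ_{Ax}` — the `IsDC` display with
    print's exterior normalizer `c·Z_{Λ^{c*c}}e^{fourthForm+fifthForm}·Z-factor·e^{thirdForm}` and the interior law (5.12.7) by name, from the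
    translated display, the numerics, the two fat-interior compatibilities `hfat`/`hfat'`, the bracket readings `hBretr`/`hBwin`/`hv`/`hX₀`/`hJ`
    of G1, and the SUPPORT READING `hXsmall`: wherever `X₀ t q v′ ψ ≠ 0` the exterior bond variables of `q` near the constrained block bonds are
    small (print: `X₀ ⊇` the small-field characteristic functions *"|A^{(k)}| ≤ cp(e_k)"* of (5.9.4)); G1's geometric readings `haOut`/`hidem`
    are DISCHARGED (`uCut_glue_fst_of_not_mem`, `uCut_gl_idem`, by the locality `BIJ88ContourSupport536.qU_congr_near`).
 §5 **`fatBonds S`** = print's `X^{c*c}` for `X = ⋃_{y∈S} B(y)` (p. 266 *"X^{c*c} includes bonds with one or both endpoints in X"*) and the two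
    compatibilities PROVED for it: **`fatBonds_compat`** (`hfat`), **`fatBonds_compat'`** (`hfat'`).
 §6 (v1.1) `near_of_mem_qUSupport` (gen 11's exact support of `(Qu)_c` lies in `Near c`), `fatBonds_hIb` and **`eq5128_gauge_fat`**: for
    `(D t).Ib = fatBonds (S t)` and the cut-off nesting `hnest` (every block bond touching a block of `S t` is a cut-off bond; print: `Λ₁₀ ⊂ Λ₁`)
    ALSO the locality reading `hv` is discharged (`BIJ88Eq5128Locality.vCut_freeze_eq_qU`) — the only hypotheses left are the numerics, the
    bracket readings `hX₀`/`hJ`/`hBm`/`hBretr`/`hBwin`, the support reading `hXsmall` and integrability.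
HONEST SCOPE.  `HChart` holds for small exterior configurations only — for large exterior fields the block averages are NOT affine in the
interior Lie-algebra variables (the branch of the logarithm jumps), so the unrestricted `∀ e` hypothesis of G1's `eq5128_gauge` is replaced
by the support reading `hXsmall`; `hBretr`/`hBwin`/`hv` (about the brackets) stay displayed; the fat-interior compatibilities `hfat`/`hfat'`
are hypotheses on the abstract `Interior`, proved in §5 for `Ib = fatBonds S` (print's `X^{c*c}` of a union of blocks, p. 266); `T`, `M`, `X₀`, `B₀` abstract as in G1; the constant `c_t` contains Mathlib's `addHaarScalarFactor` (print
absorbs it); measure `𝒟u δ_{Ax}` only (the Haar case is the same proof with `Z = ∅`).  Seat p34 gen 12, file G5b (own lineage; TAKING line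
HOME/STATUS.md 2026-08-22T07:19Z).

CITATION HEADER (lean-in-tree rule).  Part of the lit-balaban TYPED SKELETON (HOME `run/shared/lean/pub/lit-balaban/`), PHASE-2 proof seat p34
gen 12 (unit `lit-balaban-p34-g12`).  Rows served: **`C2.Eq5.12.8`** (owner r16: the gauge half of the recorded flip condition *"Wg of
`BIJ88Eq5127ProductMeasure` instantiated by name with the printed gauge Gaussian via the U(1)^{Ib} box chart (G-C2-23)"* — steps (i) `BIJ88InteriorHaarChart`,
(ii) `BIJ88InteriorFibration46`, (iii) `BIJ88FreeCoordinates48` + `BIJ88ContourSupport536`, assembly `BIJ88Eq5127GaugeSector` + THIS FILE) and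
`C2.Eq5.12.1-5.12.7`; built BY NAME on those files, r18's `BIJ85BlockAveragesTorus` (`qU`, `qU_surfMul`, `IsCross`, `coarse`, `surfMul`), p31's
`BIJ88Eq536Linearization`, gen 7's `BIJ88Eq596Display.uCut`, gen 10's frame `BIJ88Eq5128Frame`.  PDF held:
`paper:balaban1988-cmp114-bij-abelian-higgs-effective-action` (journal page = PDF page + 256).
-/

namespace Literature.MathematicalPhysics.QuantumFieldTheory.BalabanImbrieJaffe1984to88.BIJ88InteriorChartLaw

open Literature.MathematicalPhysics.QuantumFieldTheory.Balaban1983to89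
open BIJ88Sect3Statements (U1 toC)
open BIJ88Sect3Rescaling (toC_injective_U1)
open BIJ85Sect1Model (HiggsField argB argB_mem_Ico)
open BIJ85BlockAveragesTorus (qU expU1 toC_expU1 exp_argB_toC measurable_qU IsCross coarse surfMul surfFactor surfMul_of_isCross
  surfMul_of_not_isCross qU_surfMul blockOf_tgt_of_isCross blockOf_tgt_of_not_isCross)
open BIJ88RenormTransf311 (IsAxialBond axialBonds mem_axialBonds)
open BIJ88InductiveForm41 (Prev)
open BIJ88Eq596Display (uCut vCut IsDT)
open BIJ88Eq531TranslLawCutoff (measurable_uCut cutoff_apply qU_uCut)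
open BIJ88Eq5128Split (Cfg Interior)
open BIJ88Eq5128Display (IsDC termMeasure termIntegrand readEntry axialLaw)
open BIJ88Eq5128Display.Weight (normW condW)
open BIJ88Eq5128Frame (isDC_of_isDT isDT_axial_iff)
open BIJ88Eq5128ScalarSector (RIdx realCoords inIx sX)
open BIJ88Eq5127ProductMeasure (pW measurable_pW pW_pos)
open B2Eq228Conditioning (In Out blkIn)
open BIJ88ExteriorForms5121 (precK)
open BIJ88Eq536Linearization (phaseField combAvg cutoff not_isCross_of_isAxialBond)
open BIJ88ContourSupport536 (Near combAvg_congr_near qU_phaseField_near abs_mul_combAvg_le_near sfA mul_combAvg_sfA combAvg_add combAvg_smul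
  combAvgL combAvgL_apply qU_congr_near)
open BIJ88InteriorHaarChart (bondLaw)
open BIJ88InteriorHaarChart.InteriorChart (treeSet mem_treeSet μIU_axialLaw_eq_pi_bondLaw)
open BIJ88FreeCoordinates48 (sF sA act transl sF_apply_of_eq_none sF_apply_of_eq_some sA_apply_of_eq_none sA_apply_of_eq_some chartLaw_canonical
  Emat nFree jac freeEquivCanonical expU1_mul_aOf)
open BIJ88Eq5127GaugeSector (aOf measurable_aOf abs_aOf_le aOf_expU1 mul_mem_Ico_of_abs_le inIb aIn aOut gW gWg yInt HChart hfac_gauge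
  gW_glue_gaugePart integrable_gW_fibre measurable_gW gW_pos normPrint lawInt retr normW_mul_integral_condW inner_integral_eq)
open scoped BigOperators ENNReal Matrix Real
open _root_.MeasureTheory _root_.MeasureTheory.Measure Finset

noncomputable section

attribute [local instance 1001] Subtype.fintype

variable {P : Params} {k : ℕ}

/-! ## §1 One interior region and one cut-off: the constrained block bonds, the surface assignment, the glued field, the block averages -/

section One

variable (D : Interior P k) (Λ₀ : Finset (PBond P (k+1)))

/-- **THE CONSTRAINED BLOCK BONDS `Λ′^{c*c}_{10} ∩ (cut-off)`**: the block bonds of the cut-off having an interior surface bond — exactly the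
block averages that translate interior variables in `u′ = u·Q^{s*}(cut-off·(Qu)⁻¹)`. [cite: BalabanImbrieJaffe1988, (5.12.3) p.301] -/
def cset : Finset (PBond P (k+1)) := by
  classical exact Λ₀.filter fun c => ∃ b ∈ D.Ib, IsCross b ∧ coarse b = c

/-- kernel: membership in the constrained block bonds. [cite: BalabanImbrieJaffe1988, (5.12.3) p.301] -/
theorem mem_cset {c : PBond P (k+1)} : c ∈ cset D Λ₀ ↔ c ∈ Λ₀ ∧ ∃ b ∈ D.Ib, IsCross b ∧ coarse b = c := by
  classical
  unfold cset
  rw [Finset.mem_filter]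

/-- kernel: the constrained block bonds lie in the cut-off. [cite: BalabanImbrieJaffe1988, (5.12.3) p.301] -/
theorem cset_subset : cset D Λ₀ ⊆ Λ₀ := fun _ hc => ((mem_cset D Λ₀).1 hc).1

/-- the index of the constrained block bonds. [cite: BalabanImbrieJaffe1988, (5.12.3) p.301] -/
abbrev Cγ : Type := {c : PBond P (k+1) // c ∈ cset D Λ₀}

/-- the index of the interior bonds. [cite: BalabanImbrieJaffe1988, (5.12.3) p.301] -/
abbrev ιU : Type := {b : PBond P k // b ∈ D.Ib}

/-- **THE SURFACE ASSIGNMENT** `b ↦ c(b)`: an interior surface bond of a cut-off block bond is assigned to it, every other interior bond to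
nothing. [cite: BalabanImbrieJaffe1988, (5.3.1) p.280] -/
def σt (b : ιU D) : Option (Cγ D Λ₀) :=
  if h : IsCross b.1 ∧ coarse b.1 ∈ Λ₀ then some ⟨coarse b.1, (mem_cset D Λ₀).2 ⟨h.2, b.1, b.2, h.1, rfl⟩⟩ else none

/-- kernel: the surface assignment on an interior surface bond of a cut-off block bond. [cite: BalabanImbrieJaffe1988, (5.3.1) p.280] -/
theorem σt_of_pos {b : ιU D} (h : IsCross b.1 ∧ coarse b.1 ∈ Λ₀) :
    σt D Λ₀ b = some ⟨coarse b.1, (mem_cset D Λ₀).2 ⟨h.2, b.1, b.2, h.1, rfl⟩⟩ := by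
  unfold σt; rw [dif_pos h]

/-- kernel: the surface assignment elsewhere. [cite: BalabanImbrieJaffe1988, (5.3.1) p.280] -/
theorem σt_of_neg {b : ιU D} (h : ¬ (IsCross b.1 ∧ coarse b.1 ∈ Λ₀)) : σt D Λ₀ b = none := by
  unfold σt; rw [dif_neg h]

/-- **THE GLUED GAUGE FIELD**: interior variables `u`, exterior configuration `e` (previous fields and scalar field at the base point; only the
gauge field is read). [cite: BalabanImbrieJaffe1988, (5.12.7) p.302] -/
def gl (e : D.Ext) (u : D.IU) : GaugeField P k U1 := (D.glue e (u, D.base.2)).1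

/-- kernel: the glued field on an interior bond. [cite: BalabanImbrieJaffe1988, (5.12.7) p.302] -/
theorem gl_of_mem (e : D.Ext) (u : D.IU) {b : PBond P k} (hb : b ∈ D.Ib) : gl D e u b = u ⟨b, hb⟩ :=
  Interior.glue_fst_of_mem D e _ hb

/-- kernel: the glued field on an exterior bond. [cite: BalabanImbrieJaffe1988, (5.12.7) p.302] -/
theorem gl_of_not_mem (e : D.Ext) (u : D.IU) {b : PBond P k} (hb : b ∉ D.Ib) : gl D e u b = e.1 ⟨b, hb⟩ :=
  Interior.glue_fst_of_not_mem D e _ hb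

/-- kernel: gluing is measurable in the interior variables. [cite: BalabanImbrieJaffe1988, (5.12.7) p.302] -/
theorem measurable_gl (e : D.Ext) : Measurable (gl D e) :=
  measurable_fst.comp (((D.measurableEmbedding_glue e).measurable).comp (measurable_id.prodMk measurable_const))

/-- **THE BLOCK AVERAGES OF THE GLUED FIELD ON THE CONSTRAINED BLOCK BONDS** (r18's nonlinear `qU` of [2] (2.10)).
[cite: BalabanImbrieJaffe1988, (5.3.1) p.280] -/
def qt (e : D.Ext) (u : D.IU) : Cγ D Λ₀ → U1 := fun c => qU (gl D e u) c.1

/-- kernel: the block averages of the glued field are measurable in the interior variables. [cite: BalabanImbrieJaffe1988, (5.3.1) p.280] -/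
theorem measurable_qt (e : D.Ext) : Measurable (qt D Λ₀ e) :=
  measurable_pi_iff.mpr fun c => (measurable_pi_apply c.1).comp (measurable_qU.comp (measurable_gl D e))

variable {D Λ₀}

/-- **THE ABSTRACT TRANSLATION IS THE TORUS TRANSLATION**: `transl σ q u = u′_{cut-off}(u_e)|_{interior}` — this seat's `BIJ88FreeCoordinates48.transl`
for the surface assignment and the glued block averages equals gen 7's `uCut` of the glued field read on the interior bonds.
[cite: BalabanImbrieJaffe1988, (5.3.1) p.280] -/
theorem transl_eq_uCut (e : D.Ext) (u : D.IU) : transl (σt D Λ₀) (qt D Λ₀ e) u = fun b => uCut qU Λ₀ (gl D e u) b.1 := by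
  funext b
  show u b * sF (σt D Λ₀) (qt D Λ₀ e u)⁻¹ b = surfMul (gl D e u) (cutoff Λ₀ fun c => (qU (gl D e u) c)⁻¹) b.1
  by_cases h : IsCross b.1 ∧ coarse b.1 ∈ Λ₀
  · rw [sF_apply_of_eq_some (σt_of_pos D Λ₀ h), surfMul_of_isCross _ _ h.1, cutoff_apply, if_pos h.2, gl_of_mem D e u b.2]
    rfl
  · rw [sF_apply_of_eq_none (σt_of_neg D Λ₀ h)]
    by_cases hc : IsCross b.1
    · rw [surfMul_of_isCross _ _ hc, cutoff_apply, if_neg (fun hm => h ⟨hc, hm⟩), gl_of_mem D e u b.2]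
    · rw [surfMul_of_not_isCross _ _ hc, gl_of_mem D e u b.2, mul_one]

/-- kernel: no surface bond is a tree bond of `δ_{Ax}`. [cite: BalabanImbrieJaffe1988, (5.3.6) p.280] -/
theorem σt_eq_none_of_mem_treeSet {b : ιU D} (hb : b ∈ treeSet D) : σt D Λ₀ b = none :=
  σt_of_neg D Λ₀ fun h => not_isCross_of_isAxialBond (mem_axialBonds.1 ((mem_treeSet D b).1 hb)) h.1

/-- the substituting `L`-lattice field of an abstract substitution `v` on the constrained block bonds (`1` elsewhere).
[cite: BalabanImbrieJaffe1988, (5.3.1) p.280] -/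
def wOf (v : Cγ D Λ₀ → U1) : GaugeField P (k+1) U1 := fun c => if h : c ∈ cset D Λ₀ then v ⟨c, h⟩ else 1

/-- **A substitution on the interior variables IS the substitution `u ↦ u·Q^{s*}w` of the glued field** — given the FAT-INTERIOR compatibility
*"all surface bonds of a constrained block bond are interior"* (p. 266: *"X^{c*c} includes bonds with one or both endpoints in X"*).
[cite: BalabanImbrieJaffe1988, (5.3.1) p.280] -/
theorem gl_act (hfat : ∀ b ∈ D.Ib, ∀ b', IsCross b → IsCross b' → coarse b' = coarse b → coarse b ∈ Λ₀ → b' ∈ D.Ib)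
    (e : D.Ext) (v : Cγ D Λ₀ → U1) (u : D.IU) : gl D e (act (σt D Λ₀) v u) = surfMul (gl D e u) (wOf v) := by
  funext b
  by_cases hb : b ∈ D.Ib
  · rw [gl_of_mem D e _ hb, gl_act_aux]
    show u ⟨b, hb⟩ * sF (σt D Λ₀) v ⟨b, hb⟩ = gl D e u b * surfFactor (wOf v) b
    rw [gl_of_mem D e u hb]
    congr 1
    unfold surfFactor wOf
    by_cases h : IsCross b ∧ coarse b ∈ Λ₀
    · rw [sF_apply_of_eq_some (σt_of_pos D Λ₀ (b := ⟨b, hb⟩) h), if_pos h.1, dif_pos ((mem_cset D Λ₀).2 ⟨h.2, b, hb, h.1, rfl⟩)]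
    · rw [sF_apply_of_eq_none (σt_of_neg D Λ₀ (b := ⟨b, hb⟩) h)]
      by_cases hc : IsCross b
      · rw [if_pos hc, dif_neg (fun hm => h ⟨hc, cset_subset D Λ₀ hm⟩)]
      · rw [if_neg hc]
  · rw [gl_of_not_mem D e _ hb]
    show e.1 ⟨b, hb⟩ = gl D e u b * surfFactor (wOf v) b
    rw [gl_of_not_mem D e u hb]
    unfold surfFactor wOf
    by_cases hc : IsCross b
    · rw [if_pos hc, dif_neg, mul_one]
      intro hm
      obtain ⟨_, b₀, hb₀, hc₀, he₀⟩ := (mem_cset D Λ₀).1 hm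
      exact hb (hfat b₀ hb₀ b hc₀ hc he₀.symm (he₀ ▸ cset_subset D Λ₀ hm))
    · rw [if_neg hc, mul_one]
  where
  /-- pointwise form of `act` -/
  gl_act_aux : ∀ {b : ιU D}, act (σt D Λ₀) v u b = u b * sF (σt D Λ₀) v b := fun {_} => rfl

/-- **COVARIANCE OF THE BLOCK AVERAGES** (hypothesis `hcov` of the chart law): `Q(u·Q^{s*}v) = (Qu)·v` on the constrained block bonds — r18's
`qU_surfMul` for the glued field (standing range, fat-interior compatibility). [cite: BalabanImbrieJaffe1985, (3.11) p.307] -/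
theorem qt_act (hk : k + 1 ≤ P.m + P.K)
    (hfat : ∀ b ∈ D.Ib, ∀ b', IsCross b → IsCross b' → coarse b' = coarse b → coarse b ∈ Λ₀ → b' ∈ D.Ib)
    (e : D.Ext) (u : D.IU) (v : Cγ D Λ₀ → U1) : qt D Λ₀ e (act (σt D Λ₀) v u) = qt D Λ₀ e u * v := by
  funext c
  show qU (gl D e (act (σt D Λ₀) v u)) c.1 = qU (gl D e u) c.1 * v c
  rw [gl_act hfat, qU_surfMul hk]
  show qU (gl D e u) c.1 * wOf v c.1 = _
  unfold wOf
  rw [dif_pos c.2]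

/-! ## §2 The Lie-algebra data: the linearized interior averages, the exterior offset, `QQ^{s*} = 1`, the exact linearization near `Λ₁₀` -/

/-- extension by zero of an interior Lie-algebra field to all bonds. [cite: BalabanImbrieJaffe1988, (5.12.4) p.301] -/
def ΘinL (D : Interior P k) : (ιU D → ℝ) →ₗ[ℝ] (PBond P k → ℝ) where
  toFun A := fun b => if h : b ∈ D.Ib then A ⟨b, h⟩ else 0
  map_add' A B := by funext b; simp only [Pi.add_apply]; split_ifs <;> simp
  map_smul' t A := by funext b; simp only [Pi.smul_apply, smul_eq_mul, RingHom.id_apply]; split_ifs <;> simp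

/-- kernel: the extension on an interior bond. [cite: BalabanImbrieJaffe1988, (5.12.4) p.301] -/
theorem ΘinL_of_mem (A : ιU D → ℝ) {b : PBond P k} (hb : b ∈ D.Ib) : ΘinL D A b = A ⟨b, hb⟩ := by
  show (if h : b ∈ D.Ib then A ⟨b, h⟩ else 0) = _; rw [dif_pos hb]

/-- kernel: the extension on an exterior bond. [cite: BalabanImbrieJaffe1988, (5.12.4) p.301] -/
theorem ΘinL_of_not_mem (A : ιU D → ℝ) {b : PBond P k} (hb : b ∉ D.Ib) : ΘinL D A b = 0 := by
  show (if h : b ∈ D.Ib then A ⟨b, h⟩ else 0) = _; rw [dif_neg hb]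

/-- extension by zero of an exterior Lie-algebra field to all bonds. [cite: BalabanImbrieJaffe1988, (5.12.4) p.301] -/
def ΘexL (D : Interior P k) : (Out (inIb D) → ℝ) →ₗ[ℝ] (PBond P k → ℝ) where
  toFun a := fun b => if h : b ∈ D.Ib then 0 else a ⟨b, h⟩
  map_add' A B := by funext b; simp only [Pi.add_apply]; split_ifs <;> simp
  map_smul' t A := by funext b; simp only [Pi.smul_apply, smul_eq_mul, RingHom.id_apply]; split_ifs <;> simp

/-- kernel: the exterior extension on an interior bond. [cite: BalabanImbrieJaffe1988, (5.12.4) p.301] -/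
theorem ΘexL_of_mem (a : Out (inIb D) → ℝ) {b : PBond P k} (hb : b ∈ D.Ib) : ΘexL D a b = 0 := by
  show (if h : b ∈ D.Ib then 0 else a ⟨b, h⟩) = _; rw [dif_pos hb]

/-- kernel: the exterior extension on an exterior bond. [cite: BalabanImbrieJaffe1988, (5.12.4) p.301] -/
theorem ΘexL_of_not_mem (a : Out (inIb D) → ℝ) {b : PBond P k} (hb : b ∉ D.Ib) : ΘexL D a b = a ⟨b, hb⟩ := by
  show (if h : b ∈ D.Ib then 0 else a ⟨b, h⟩) = _; rw [dif_neg hb]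

variable (D Λ₀)

/-- **THE LINEARIZED INTERIOR BLOCK AVERAGES `Q_{in}`** on the constrained block bonds: `L·(full contour average of [2] (2.10)/(2.13))` of the
interior field extended by zero. [cite: BalabanImbrieJaffe1985, (2.13) p.304] -/
def Qm : (ιU D → ℝ) →ₗ[ℝ] (Cγ D Λ₀ → ℝ) where
  toFun A := fun c => P.L * combAvg (ΘinL D A) c.1
  map_add' A B := by funext c; rw [Pi.add_apply, map_add, combAvg_add, mul_add]
  map_smul' t A := by funext c; rw [Pi.smul_apply, map_smul, combAvg_smul, smul_eq_mul, RingHom.id_apply]; ring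

/-- kernel: the linearized interior averages, pointwise. [cite: BalabanImbrieJaffe1985, (2.13) p.304] -/
theorem Qm_apply (A : ιU D → ℝ) (c : Cγ D Λ₀) : Qm D Λ₀ A c = P.L * combAvg (ΘinL D A) c.1 := rfl

/-- **THE EXTERIOR OFFSET `θ = Q_{out}a`**: the linearized averages of the exterior Lie-algebra field `a` on the constrained block bonds (print's
`QΛ^{c*}_{10}A` in (5.12.4)). [cite: BalabanImbrieJaffe1988, (5.12.4) p.301] -/
def θOf (a : Out (inIb D) → ℝ) : Cγ D Λ₀ → ℝ := fun c => P.L * combAvg (ΘexL D a) c.1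

/-- the matrix of `a ↦ θ(a)`. [cite: BalabanImbrieJaffe1988, (5.12.4) p.301] -/
def Rmat : Matrix (Cγ D Λ₀) (Out (inIb D)) ℝ := fun c b' => P.L * combAvg (ΘexL D (Pi.single b' 1)) c.1

/-- the matrix of the Lie-algebra `Q^{s*}` of the surface assignment. [cite: BalabanImbrieJaffe1988, (5.12.4) p.301] -/
def Smat : Matrix (ιU D) (Cγ D Λ₀) ℝ := fun b c => if σt D Λ₀ b = some c then 1 else 0

/-- **THE MATRIX `R = Q^{s*}Q_{out}` OF THE TRANSLATION (5.12.4)** `A = A′ − Λ^{c*c}_{10}Q^{s*}QΛ^{c*}_{10}A` read on the interior bonds.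
[cite: BalabanImbrieJaffe1988, (5.12.4) p.301] -/
def Rt : Matrix (ιU D) (Out (inIb D)) ℝ := Smat D Λ₀ * Rmat D Λ₀

variable {D Λ₀}

/-- kernel: the matrix of `θ` acts as `θ`. [cite: BalabanImbrieJaffe1988, (5.12.4) p.301] -/
theorem Rmat_mulVec (a : Out (inIb D) → ℝ) : Rmat D Λ₀ *ᵥ a = θOf D Λ₀ a := by
  funext c
  let φ : (Out (inIb D) → ℝ) →ₗ[ℝ] ℝ := (P.L : ℝ) • (combAvgL c.1 ∘ₗ ΘexL D)
  have hφ : ∀ a', φ a' = P.L * combAvg (ΘexL D a') c.1 := fun _ => rfl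
  have hsingle : ∀ b', (Pi.single b' (a b') : Out (inIb D) → ℝ) = a b' • (Pi.single b' (1 : ℝ) : Out (inIb D) → ℝ) := fun b' => by
    ext j; simp [Pi.single_apply]
  show ∑ b', Rmat D Λ₀ c b' * a b' = θOf D Λ₀ a c
  simp only [Rmat, θOf, ← hφ]
  calc ∑ b', φ (Pi.single b' 1) * a b' = ∑ b', φ (Pi.single b' (a b')) :=
        Finset.sum_congr rfl fun b' _ => by rw [hsingle, map_smul, smul_eq_mul, mul_comm]
    _ = φ (∑ b', Pi.single b' (a b')) := (_root_.map_sum φ _ _).symm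
    _ = φ a := by rw [Finset.univ_sum_single]

/-- kernel: the matrix of the surface assignment acts as `Q^{s*}`. [cite: BalabanImbrieJaffe1988, (5.12.4) p.301] -/
theorem Smat_mulVec (w : Cγ D Λ₀ → ℝ) : Smat D Λ₀ *ᵥ w = sA (σt D Λ₀) w := by
  funext b
  simp only [Matrix.mulVec, dotProduct, Smat]
  cases h : σt D Λ₀ b with
  | none => rw [sA_apply_of_eq_none h]; simp
  | some c =>
    rw [sA_apply_of_eq_some h, Finset.sum_eq_single c]
    · simp
    · intro c' _ hc'; rw [if_neg (fun hh => hc' (Option.some_injective _ hh).symm), zero_mul]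
    · intro hc; exact absurd (Finset.mem_univ c) hc

/-- **`R·a = Q^{s*}θ(a)`** — the offset of the box of free coordinates is the surface field of the exterior averages.
[cite: BalabanImbrieJaffe1988, (5.12.4) p.301] -/
theorem Rt_mulVec (a : Out (inIb D) → ℝ) : Rt D Λ₀ *ᵥ a = sA (σt D Λ₀) (θOf D Λ₀ a) := by
  rw [Rt, ← Matrix.mulVec_mulVec, Rmat_mulVec, Smat_mulVec]

/-- **`QQ^{s*} = 1` IN THE LIE ALGEBRA** (hypothesis `hQS` of the chart law): the linearized interior averages of the surface field `Q^{s*}w` are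
`w` — this seat's `BIJ88ContourSupport536.mul_combAvg_sfA` ([2] (2.19) p. 305 *"by (2.13), QQ^{s*} = I"*) under the fat-interior
compatibility (standing range). [cite: BalabanImbrieJaffe1985, (2.19) p.305] -/
theorem Qm_sA (hk : k + 1 ≤ P.m + P.K)
    (hfat : ∀ b ∈ D.Ib, ∀ b', IsCross b → IsCross b' → coarse b' = coarse b → coarse b ∈ Λ₀ → b' ∈ D.Ib) (w : Cγ D Λ₀ → ℝ) :
    Qm D Λ₀ (sA (σt D Λ₀) w) = w := by
  funext c
  have hfield : ΘinL D (sA (σt D Λ₀) w) = sfA (fun c' => if h : c' ∈ cset D Λ₀ then w ⟨c', h⟩ else 0) := by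
    funext b
    by_cases hb : b ∈ D.Ib
    · rw [ΘinL_of_mem _ hb]
      by_cases h : IsCross b ∧ coarse b ∈ Λ₀
      · have hm : coarse b ∈ cset D Λ₀ := (mem_cset D Λ₀).2 ⟨h.2, b, hb, h.1, rfl⟩
        rw [sA_apply_of_eq_some (σt_of_pos D Λ₀ (b := ⟨b, hb⟩) h)]
        simp only [sfA, if_pos h.1, dif_pos hm]
      · rw [sA_apply_of_eq_none (σt_of_neg D Λ₀ (b := ⟨b, hb⟩) h)]
        by_cases hc : IsCross b
        · have hm : coarse b ∉ cset D Λ₀ := fun hm => h ⟨hc, cset_subset D Λ₀ hm⟩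
          simp only [sfA, if_pos hc, dif_neg hm]
        · simp only [sfA, if_neg hc]
    · rw [ΘinL_of_not_mem _ hb]
      by_cases hc : IsCross b
      · have hm : coarse b ∉ cset D Λ₀ := by
          intro hm
          obtain ⟨_, b₀, hb₀, hc₀, he₀⟩ := (mem_cset D Λ₀).1 hm
          exact hb (hfat b₀ hb₀ b hc₀ hc he₀.symm (he₀ ▸ cset_subset D Λ₀ hm))
        simp only [sfA, if_pos hc, dif_neg hm]
      · simp only [sfA, if_neg hc]
  rw [Qm_apply, hfield, mul_combAvg_sfA hk]
  show (if h : c.1 ∈ cset D Λ₀ then w ⟨c.1, h⟩ else 0) = w c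
  rw [dif_pos c.2]

/-- kernel: `e^{i·argB(toC g)} = g` — the principal argument is a logarithm. [cite: BalabanImbrieJaffe1985, (2.12) p.303] -/
theorem expU1_argB_toC (g : U1) : expU1 (argB (toC g)) = g := by
  apply toC_injective_U1
  rw [toC_expU1, exp_argB_toC]

/-- **THE GLUED FIELD OF A SMALL INTERIOR LIE-ALGEBRA FIELD IS A PHASE FIELD**: `u_e(e^{ie_kA}) = e^{iΘ}` with `Θ = e_kA` on the interior bonds and
`Θ = argB(toC e_b)` (the principal logarithm of the exterior variables) outside. [cite: BalabanImbrieJaffe1988, (5.3.1) p.280] -/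
theorem gl_expU1_eq_phaseField (e : D.Ext) (ek : ℝ) (A : ιU D → ℝ) :
    gl D e (fun b => expU1 (ek * A b)) =
      phaseField (fun b => if h : b ∈ D.Ib then ek * A ⟨b, h⟩ else argB (toC (e.1 ⟨b, h⟩))) := by
  funext b
  show gl D e (fun b => expU1 (ek * A b)) b = expU1 (if h : b ∈ D.Ib then ek * A ⟨b, h⟩ else argB (toC (e.1 ⟨b, h⟩)))
  by_cases hb : b ∈ D.Ib
  · rw [gl_of_mem D e _ hb, dif_pos hb]
  · rw [gl_of_not_mem D e _ hb, dif_neg hb, expU1_argB_toC]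

/-- kernel: an exterior bond near a constrained block bond is not a surface bond (its surface bonds are all interior: fat-interior
compatibility). [cite: BalabanImbrieJaffe1988, (5.12.4) p.301] -/
theorem not_isCross_of_near (hfat : ∀ b ∈ D.Ib, ∀ b', IsCross b → IsCross b' → coarse b' = coarse b → coarse b ∈ Λ₀ → b' ∈ D.Ib)
    {c : Cγ D Λ₀} {b : PBond P k} (hb : b ∉ D.Ib) (hn : Near c.1 b) : ¬ IsCross b := by
  intro hc
  have hcb : coarse b = c.1 := hn.2 hc
  obtain ⟨hΛ, b₀, hb₀, hc₀, he₀⟩ := (mem_cset D Λ₀).1 c.2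
  exact hb (hfat b₀ hb₀ b hc₀ hc (hcb.trans he₀.symm) (he₀ ▸ hΛ))

/-- kernel: on an exterior bond near a constrained block bond the translated variable is the untranslated one (no substitution off the
surface bonds). [cite: BalabanImbrieJaffe1988, (5.3.1) p.280] -/
theorem uCut_gl_of_near (hfat : ∀ b ∈ D.Ib, ∀ b', IsCross b → IsCross b' → coarse b' = coarse b → coarse b ∈ Λ₀ → b' ∈ D.Ib)
    {c : Cγ D Λ₀} {b : PBond P k} (hb : b ∉ D.Ib) (hn : Near c.1 b) (e : D.Ext) (u : D.IU) : uCut qU Λ₀ (gl D e u) b = e.1 ⟨b, hb⟩ := by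
  show surfMul (gl D e u) _ b = _
  rw [surfMul_of_not_isCross _ _ (not_isCross_of_near hfat hb hn), gl_of_not_mem D e u hb]

/-- **THE EXTERIOR TRANSLATED VARIABLES DO NOT DEPEND ON THE INTERIOR ONES** (the geometric reading `haOut` of
`BIJ88Eq5127GaugeSector.eq5128_gauge`, discharged): `u′_{cut-off}(u_e(i))_{b′} = u′_{cut-off}(u_e(1))_{b′}` on every exterior bond `b′` — by the
locality of `(Qu)_c` (`BIJ88ContourSupport536.qU_congr_near`) under the second fat-interior compatibility: the block bonds of exterior surface
bonds see no interior bond (p. 266; standing range). [cite: BalabanImbrieJaffe1988, (5.3.1) p.280] -/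
theorem uCut_glue_fst_of_not_mem (hk : k + 1 ≤ P.m + P.K)
    (hfat' : ∀ b', b' ∉ D.Ib → IsCross b' → coarse b' ∈ Λ₀ → ∀ b, Near (coarse b') b → b ∉ D.Ib)
    (e : D.Ext) (i : D.Int) {b' : PBond P k} (hb' : b' ∉ D.Ib) :
    uCut qU Λ₀ (D.glue e i).1 b' = uCut qU Λ₀ (D.glue e D.base).1 b' := by
  show surfMul _ _ b' = surfMul _ _ b'
  by_cases hc : IsCross b'
  · rw [surfMul_of_isCross _ _ hc, surfMul_of_isCross _ _ hc, Interior.glue_fst_of_not_mem _ _ _ hb',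
      Interior.glue_fst_of_not_mem _ _ _ hb']
    simp only [cutoff_apply]
    by_cases hm : coarse b' ∈ Λ₀
    · rw [if_pos hm, if_pos hm, qU_congr_near hk (U := (D.glue e i).1) (U' := (D.glue e D.base).1) fun b hn => ?_]
      have hb : b ∉ D.Ib := hfat' b' hb' hc hm b hn
      rw [Interior.glue_fst_of_not_mem _ _ _ hb, Interior.glue_fst_of_not_mem _ _ _ hb]
    · rw [if_neg hm, if_neg hm]
  · rw [surfMul_of_not_isCross _ _ hc, surfMul_of_not_isCross _ _ hc, Interior.glue_fst_of_not_mem _ _ _ hb',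
      Interior.glue_fst_of_not_mem _ _ _ hb']

/-- **THE TRANSLATION IS IDEMPOTENT ON THE INTERIOR** (the geometric reading `hidem` of `BIJ88Eq5127GaugeSector.eq5128_gauge`, discharged):
`u′(u_e(u′(u_e(u))|_{int}))|_{int} = u′(u_e(u))|_{int}` — the block averages of the translated field are `1` on the cut-off (gen 7's `qU_uCut`),
also after re-gluing the exterior (locality, first fat-interior compatibility; standing range). [cite: BalabanImbrieJaffe1988, (5.3.6) p.280] -/
theorem uCut_gl_idem (hk : k + 1 ≤ P.m + P.K)
    (hfat : ∀ b ∈ D.Ib, ∀ b', IsCross b → IsCross b' → coarse b' = coarse b → coarse b ∈ Λ₀ → b' ∈ D.Ib) (e : D.Ext) (u : D.IU) :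
    (fun b : ιU D => uCut qU Λ₀ (gl D e fun b₂ : ιU D => uCut qU Λ₀ (gl D e u) b₂.1) b.1) = fun b => uCut qU Λ₀ (gl D e u) b.1 := by
  funext b
  set u' : D.IU := fun b₂ => uCut qU Λ₀ (gl D e u) b₂.1 with hu'
  show surfMul (gl D e u') (cutoff Λ₀ fun c => (qU (gl D e u') c)⁻¹) b.1 = u' b
  by_cases hc : IsCross b.1
  · rw [surfMul_of_isCross _ _ hc, gl_of_mem D e u' b.2]
    simp only [cutoff_apply]
    by_cases hm : coarse b.1 ∈ Λ₀
    · have hcm : coarse b.1 ∈ cset D Λ₀ := (mem_cset D Λ₀).2 ⟨hm, b.1, b.2, hc, rfl⟩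
      have hq : qU (gl D e u') (coarse b.1) = qU (uCut qU Λ₀ (gl D e u)) (coarse b.1) := by
        refine qU_congr_near hk fun b₂ hn => ?_
        by_cases hb₂ : b₂ ∈ D.Ib
        · rw [gl_of_mem D e u' hb₂]
        · rw [gl_of_not_mem D e u' hb₂, uCut_gl_of_near hfat (c := ⟨coarse b.1, hcm⟩) hb₂ hn]
      have h1 : qU (uCut qU Λ₀ (gl D e u)) (coarse b.1) = 1 := by
        show qU (surfMul _ (cutoff Λ₀ fun c => (qU (gl D e u) c)⁻¹)) (coarse b.1) = 1
        rw [qU_uCut hk]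
        exact if_pos hm
      rw [if_pos hm, hq, h1, inv_one, mul_one]
    · rw [if_neg hm, mul_one]
  · rw [surfMul_of_not_isCross _ _ hc, gl_of_mem D e u' b.2]

variable (D Λ₀) in
/-- **THE EXTERIOR TRANSLATED LIE-ALGEBRA VARIABLES `a = Λ^{c*}A`** of an exterior configuration (this seat's `BIJ88Eq5127GaugeSector.aOut` at the
frozen configuration, `aOut_glue_base`). [cite: BalabanImbrieJaffe1988, (5.12.4) p.301] -/
def aOutV (ek : ℝ) (e : D.Ext) : Out (inIb D) → ℝ := fun b' => aOf ek (uCut qU Λ₀ (gl D e fun _ => 1) b'.1)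

/-- **THE EXACT LINEARIZATION NEAR `Λ₁₀`** (hypothesis `hlin` of the chart law): for an interior Lie-algebra field with `|A_b| ≤ τ` and an
exterior configuration whose bond variables near the constrained block bonds have `|(ie_k)⁻¹log| ≤ τ`, `2(d+1)L·e_kτ < π`:
`Q(u_e(e^{ie_kA}))_c = e^{ie_k((Q_{in}A)_c + θ(a(e))_c)}` on every constrained block bond, `a(e)` = the exterior translated Lie-algebra variables
(this seat's `BIJ88Eq5127GaugeSector.aOut` at the frozen configuration) — p31's linearization made LOCAL by `BIJ88ContourSupport536`.
[cite: BalabanImbrieJaffe1988, (5.3.6) p.280] -/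
theorem qt_expU1 (hk : k + 1 ≤ P.m + P.K) {ek τ : ℝ} (hek : 0 < ek) (hτ0 : 0 ≤ τ) (hnum : 2 * ((P.d : ℝ) + 1) * P.L * (ek * τ) < π)
    (hfat : ∀ b ∈ D.Ib, ∀ b', IsCross b → IsCross b' → coarse b' = coarse b → coarse b ∈ Λ₀ → b' ∈ D.Ib)
    (e : D.Ext) (hext : ∀ c ∈ cset D Λ₀, ∀ b (hb : b ∉ D.Ib), Near c b → |aOf ek (e.1 ⟨b, hb⟩)| ≤ τ)
    (A : ιU D → ℝ) (hA : ∀ b, |A b| ≤ τ) (c : Cγ D Λ₀) :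
    qt D Λ₀ e (fun b => expU1 (ek * A b)) c =
        expU1 (ek * (Qm D Λ₀ A c + θOf D Λ₀ (aOutV D Λ₀ ek e) c)) ∧
      |ek * (Qm D Λ₀ A c + θOf D Λ₀ (aOutV D Λ₀ ek e) c)| < π := by
  set Θ : PBond P k → ℝ := fun b => if h : b ∈ D.Ib then ek * A ⟨b, h⟩ else argB (toC (e.1 ⟨b, h⟩)) with hΘ
  have hekτ : ek * τ < π := by
    have hL : (1 : ℝ) ≤ P.L := by exact_mod_cast P.L_pos
    have hd : (0 : ℝ) ≤ P.d := Nat.cast_nonneg _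
    have hK : (1 : ℝ) ≤ 2 * ((P.d : ℝ) + 1) * P.L := by nlinarith
    have h1 := mul_le_mul_of_nonneg_right hK (mul_nonneg hek.le hτ0)
    rw [one_mul] at h1
    exact h1.trans_lt hnum
  -- the phase field is in the principal branch everywhere and small near `c`
  have hIco : ∀ b, Θ b ∈ Set.Ico (-π) π := by
    intro b
    by_cases hb : b ∈ D.Ib
    · simp only [hΘ, dif_pos hb]; exact mul_mem_Ico_of_abs_le hek hekτ (hA _)
    · simp only [hΘ, dif_neg hb]; exact argB_mem_Ico _
  have hnear : ∀ b, Near c.1 b → |Θ b| ≤ ek * τ := by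
    intro b hn
    by_cases hb : b ∈ D.Ib
    · simp only [hΘ, dif_pos hb]; rw [abs_mul, abs_of_pos hek]; exact mul_le_mul_of_nonneg_left (hA _) hek.le
    · simp only [hΘ, dif_neg hb]
      have h := hext c.1 c.2 b hb hn
      rw [aOf, abs_div, abs_of_pos hek, div_le_iff₀ hek] at h
      linarith [h]
  -- the full average of `Θ` over `c` is the interior part plus the exterior part read through `aOut`
  have hsplit : ∀ b, Near c.1 b →
      Θ b = (ek • (ΘinL D A + ΘexL D (aOutV D Λ₀ ek e))) b := by
    intro b hn
    rw [Pi.smul_apply, Pi.add_apply, smul_eq_mul]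
    by_cases hb : b ∈ D.Ib
    · simp only [hΘ, dif_pos hb]; rw [ΘinL_of_mem _ hb, ΘexL_of_mem _ hb, add_zero]
    · simp only [hΘ, dif_neg hb]
      rw [ΘinL_of_not_mem _ hb, ΘexL_of_not_mem _ hb, zero_add]
      show argB (toC (e.1 ⟨b, hb⟩)) = ek * aOf ek (uCut qU Λ₀ (gl D e fun _ => 1) b)
      rw [uCut_gl_of_near hfat hb hn, aOf, mul_div_cancel₀ _ hek.ne']
  have havg : (P.L : ℝ) * combAvg Θ c.1 =
      ek * (Qm D Λ₀ A c + θOf D Λ₀ (aOutV D Λ₀ ek e) c) := by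
    rw [combAvg_congr_near hk hsplit, combAvg_smul, combAvg_add, Qm_apply, θOf]
    ring
  refine ⟨?_, ?_⟩
  · show qU (gl D e fun b => expU1 (ek * A b)) c.1 = _
    rw [gl_expU1_eq_phaseField, qU_phaseField_near hk hIco (mul_nonneg hek.le hτ0) hnear hnum, havg]
  · rw [← havg]
    exact (abs_mul_combAvg_le_near hk (mul_nonneg hek.le hτ0) hnear).trans_lt hnum

end One

/-! ## §3 `HChart` DISCHARGED on the torus for exterior configurations small near `Λ₁₀` -/

section Chart

variable {ι : Type*} (Λ : ι → Finset (PBond P (k+1))) (D : ι → Interior P k) (ek : ℝ)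

/-- the free-coordinate index of the term `t`: `‖Λ_t‖` coordinates. [cite: BalabanImbrieJaffe1988, (4.8) p.275] -/
abbrev ιf (t : ι) : Type := Fin (nFree (treeSet (D t)) (Qm (D t) (Λ t)))

/-- **THE MATRIX `E` OF FREE COORDINATES** of the term `t` (a basis of the space of free integrations of its interior).
[cite: BalabanImbrieJaffe1988, (4.8) p.275] -/
def Et (t : ι) : Matrix (In (inIb (D t))) (ιf Λ D t) ℝ := Emat (treeSet (D t)) (Qm (D t) (Λ t))

/-- **THE TRANSLATION MATRIX `R`** of the term `t`. [cite: BalabanImbrieJaffe1988, (5.12.4) p.301] -/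
def Rtt (t : ι) : Matrix (In (inIb (D t))) (Out (inIb (D t))) ℝ := Rt (D t) (Λ t)

variable {Λ D}

/-- kernel: hypothesis `hσZ` per term. [cite: BalabanImbrieJaffe1988, (5.3.6) p.280] -/
theorem hσZ_t (t : ι) : ∀ b ∈ treeSet (D t), σt (D t) (Λ t) b = none := fun _ hb => σt_eq_none_of_mem_treeSet hb

variable (Λ D) in
/-- **THE CONSTANT `c_t = (e_k/2π)^{‖Λ_t‖}·J_t`** of the chart law of the term `t`. [cite: BalabanImbrieJaffe1988, (5.12.3) p.301] -/
def ct (hk : k + 1 ≤ P.m + P.K)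
    (hfat : ∀ t, ∀ b ∈ (D t).Ib, ∀ b', IsCross b → IsCross b' → coarse b' = coarse b → coarse b ∈ Λ t → b' ∈ (D t).Ib) (t : ι) : ℝ :=
  (ek / (2 * π)) ^ nFree (treeSet (D t)) (Qm (D t) (Λ t)) * (jac (freeEquivCanonical (hσZ_t t) (Qm_sA hk (hfat t))) : ℝ)

/-- kernel: the chart constant is non-negative. [cite: BalabanImbrieJaffe1988, (5.12.3) p.301] -/
theorem ct_nonneg (hk : k + 1 ≤ P.m + P.K)
    (hfat : ∀ t, ∀ b ∈ (D t).Ib, ∀ b', IsCross b → IsCross b' → coarse b' = coarse b → coarse b ∈ Λ t → b' ∈ (D t).Ib)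
    (hek : 0 < ek) (t : ι) : 0 ≤ ct Λ D ek hk hfat t :=
  mul_nonneg (pow_nonneg (by positivity) _) (NNReal.coe_nonneg _)

/-- **`HChart` OF `BIJ88Eq5127GaugeSector` DISCHARGED ON THE TORUS (measure `𝒟u δ_{Ax}`)**: for every term `t` and every exterior
configuration `e` whose bond variables near the constrained block bonds of `Λ_t` satisfy `|(ie_k)⁻¹log e_b| ≤ r + ε`, the law of the translated
interior gauge variables under `Π_{b∈Λ^{c*c}_{10}} (δ_{Ax}? δ_1 : du_b)`, restricted to the window `{|A′_b| ≤ r}`, IS `c_t ·` the image of Lebesgue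
measure on the unwrapped box under the affine chart with `E = Et`, `R = Rtt`, `c_t = (e_k/2π)^{‖Λ_t‖}·J_t` — hypotheses: standing range, `e_k > 0`,
`r ≥ 0`, `ε > 0`, `2(d+1)L·e_k(r + ε) < π`, fat-interior compatibility. [cite: BalabanImbrieJaffe1988, (5.12.3) p.301] -/
theorem hChart (hk : k + 1 ≤ P.m + P.K) {r ε : ℝ} (hek : 0 < ek) (hr : 0 ≤ r) (hε : 0 < ε)
    (hnum : 2 * ((P.d : ℝ) + 1) * P.L * (ek * (r + ε)) < π)
    (hfat : ∀ t, ∀ b ∈ (D t).Ib, ∀ b', IsCross b → IsCross b' → coarse b' = coarse b → coarse b ∈ Λ t → b' ∈ (D t).Ib)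
    (t : ι) (e : (D t).Ext)
    (hext : ∀ c ∈ cset (D t) (Λ t), ∀ b (hb : b ∉ (D t).Ib), Near c b → |aOf ek (e.1 ⟨b, hb⟩)| ≤ r + ε) :
    HChart Λ D ek (Et Λ D) (Rtt Λ D) (ct Λ D ek hk hfat) r (axialLaw P k) t e := by
  have hsmall : ek * (r + ε) < π := by
    have hL : (1 : ℝ) ≤ P.L := by exact_mod_cast P.L_pos
    have hd : (0 : ℝ) ≤ P.d := Nat.cast_nonneg _
    have hK : (1 : ℝ) ≤ 2 * ((P.d : ℝ) + 1) * P.L := by nlinarith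
    have h1 := mul_le_mul_of_nonneg_right hK (mul_nonneg hek.le (by linarith : (0 : ℝ) ≤ r + ε))
    rw [one_mul] at h1
    exact h1.trans_lt hnum
  -- the abstract chart law for the torus data of the term `t`, exterior `e`
  have hlaw := chartLaw_canonical (Z := treeSet (D t)) (σ := σt (D t) (Λ t)) (q := qt (D t) (Λ t) e) (ek := ek) (r := r) (ε := ε)
    (θ := θOf (D t) (Λ t) (aOutV (D t) (Λ t) ek e)) (Qm := Qm (D t) (Λ t))
    hek hε hr hsmall (hσZ_t t) (measurable_qt (D t) (Λ t) e) (fun u v => qt_act hk (hfat t) e u v)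
    (fun A hA _ => funext fun c => (qt_expU1 hk hek (by linarith) hnum (hfat t) e hext A hA c).1)
    (fun A hA _ c => (qt_expU1 hk hek (by linarith) hnum (hfat t) e hext A hA c).2) (Qm_sA hk (hfat t))
  -- read it in the vocabulary of `BIJ88Eq5127GaugeSector`
  unfold HChart
  have hμ : (D t).μIU (axialLaw P k) = Measure.pi (bondLaw (treeSet (D t))) := μIU_axialLaw_eq_pi_bondLaw (D t)
  have hy : yInt Λ D t e = transl (σt (D t) (Λ t)) (qt (D t) (Λ t) e) := by
    funext u; rw [transl_eq_uCut]; rfl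
  have haout : aOut Λ D ek t ((D t).glue e (D t).base) = aOutV (D t) (Λ t) ek e := rfl
  have hoff : Rtt Λ D t *ᵥ aOut Λ D ek t ((D t).glue e (D t).base) = sA (σt (D t) (Λ t)) (θOf (D t) (Λ t) (aOutV (D t) (Λ t) ek e)) := by
    rw [haout, Rtt, Rt_mulVec]
  rw [hμ, hy]
  have hwin : BIJ88Eq5127GaugeSector.win (D := D) ek r t = BIJ88FreeCoordinates48.win ek r := rfl
  have hbox : BIJ88Eq5127GaugeSector.box Λ D ek (Et Λ D) (Rtt Λ D) r t e =
      BIJ88FreeCoordinates48.box r (Et Λ D t) (Rtt Λ D t *ᵥ aOut Λ D ek t ((D t).glue e (D t).base)) := rfl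
  have haff : BIJ88Eq5127GaugeSector.affChart Λ D ek (Et Λ D) (Rtt Λ D) t e =
      BIJ88FreeCoordinates48.affChart ek (Et Λ D t) (Rtt Λ D t *ᵥ aOut Λ D ek t ((D t).glue e (D t).base)) := rfl
  rw [hwin, hbox, haff, hoff, hlaw]
  rfl

end Chart

/-! ## §4 Row C2.Eq5.12.8 with the chart law used only where the exterior bracket lives -/

section Main

variable {ι : Type*} {Λ : ι → Finset (PBond P (k+1))} {D : ι → Interior P k} {ek : ℝ} {T : ι → Matrix (PBond P k) (PBond P k) ℝ}
variable {M : ι → GaugeField P (k+1) U1 → Matrix (RIdx P k) (RIdx P k) ℝ}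
variable {ιg : ι → Type} [∀ t, Fintype (ιg t)] [∀ t, DecidableEq (ιg t)]
variable {E : (t : ι) → Matrix (In (inIb (D t))) (ιg t) ℝ} {R : (t : ι) → Matrix (In (inIb (D t))) (Out (inIb (D t))) ℝ} {c : ι → ℝ} {r : ℝ}
variable {m : PBond P k → Measure U1} [∀ b, IsProbabilityMeasure (m b)]

/-- **`BIJ88Eq5127GaugeSector.eq5128_gauge` WITH THE CHART LAW REQUIRED ONLY ON THE SUPPORT OF THE EXTERIOR BRACKET**: the renormalization
congruence is trivial where `X₀ = 0`, so `HChart` is needed only at the exterior configurations `e` of configurations `q` with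
`X₀ t q v′ ψ ≠ 0` (print: `X₀ ⊇` the small-field characteristic functions of the exterior variables near `Λ₁₀`).
[cite: BalabanImbrieJaffe1988, (5.12.8) p.303] -/
theorem eq5128_gauge_of_support {terms : Finset ι}
    {J : ι → Prev P k → GaugeField P k U1 → GaugeField P (k+1) U1 → HiggsField P k → HiggsField P (k+1) → ℂ}
    {ρL : GaugeField P (k+1) U1 → HiggsField P (k+1) → ℂ}
    (h : IsDT (Measure.pi m) terms Λ qU J ρL)
    (hek : 0 < ek) (hr : ek * r < π) (hT : ∀ t, (T t).IsSymm) (hK : ∀ t, (precK (inIb (D t)) (T t) (E t)).PosDef)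
    (hMs : ∀ t v, (M t v).IsSymm) (hMpd : ∀ t v, (blkIn (inIx (D t)) (M t v)).PosDef) (hMm : ∀ t i j, Measurable fun v => M t v i j)
    (hc : ∀ t, 0 ≤ c t)
    (X₀ B₀ : ι → Cfg P k → GaugeField P (k+1) U1 → HiggsField P (k+1) → ℂ)
    (hv : ∀ t ∈ terms, ∀ (q : Cfg P k) (v' : GaugeField P (k+1) U1), vCut qU (Λ t) ((D t).freeze q).1 v' = vCut qU (Λ t) q.1 v')
    (hX₀ : ∀ t ∈ terms, ∀ q v' ψ, X₀ t ((D t).freeze q) v' ψ = X₀ t q v' ψ)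
    (hJ : ∀ t ∈ terms, ∀ q v' ψ, readEntry Λ qU J t q v' ψ =
      X₀ t q v' ψ * (gW Λ D ek T t q : ℂ) *
        (Real.exp (-(1 / 2 : ℝ) * (realCoords q.2.2 ⬝ᵥ (M t (vCut qU (Λ t) q.1 v') *ᵥ realCoords q.2.2))) : ℂ) * B₀ t q v' ψ)
    (haOut : ∀ t ∈ terms, ∀ (e : (D t).Ext) (i : (D t).Int), aOut Λ D ek t ((D t).glue e i) = aOut Λ D ek t ((D t).glue e (D t).base))
    (hidem : ∀ t ∈ terms, ∀ (e : (D t).Ext) (i₁ : (D t).IU), yInt Λ D t e (yInt Λ D t e i₁) = yInt Λ D t e i₁)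
    (hBm : ∀ t v' ψ, Measurable fun q => B₀ t q v' ψ)
    (hBretr : ∀ t ∈ terms, ∀ (e : (D t).Ext) (i : (D t).Int) v' ψ, B₀ t ((D t).glue e i) v' ψ = B₀ t ((D t).glue e (retr Λ D t e i)) v' ψ)
    (hBwin : ∀ t ∈ terms, ∀ q v' ψ, B₀ t q v' ψ ≠ 0 → ∀ b, |aIn Λ D ek t q b| ≤ r)
    (hch : ∀ t ∈ terms, ∀ q v' ψ, X₀ t q v' ψ ≠ 0 → HChart Λ D ek E R c r m t ((D t).split q).1)
    (hJi : ∀ t ∈ terms, Integrable (termIntegrand Λ qU J t) (termMeasure (Measure.pi m))) :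
    IsDC terms Λ qU (fun t => (D t).extMeasure m)
      (fun t q v' ψ => X₀ t q v' ψ * (sX Λ qU D M t q v' : ℂ) * (normPrint Λ D ek T M E R c t ((D t).split q).1 v' : ℂ))
      (fun t q v' _ => (D t).fibreMeasure (lawInt Λ D ek T M E R r t ((D t).split q).1 v') ((D t).split q).1) B₀ ρL := by
  have h1 := isDC_of_isDT h measurable_qU D (fun t q v' ψ => X₀ t q v' ψ * (sX Λ qU D M t q v' : ℂ)) B₀ (pW Λ qU D M (gWg Λ D ek T)) hv
    (hfac_gauge hMs hv hX₀ hJ) (fun t _ => measurable_pW measurable_qU hMm measurable_gW t)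
    (fun t _ q v' ψ => pW_pos (fun t q _ _ => gW_pos t q) t q v' ψ)
    (fun t ht e v' ψ => BIJ88Eq5127ProductMeasure.integrable_pW_fibre hMs hMpd t v' ψ (fun q => hv t ht q v')
      (fun e i => gW_glue_gaugePart t e i) (fun e => integrable_gW_fibre hek t e) e) hJi
  refine h1.congr_inner fun t ht q v' ψ => ?_
  by_cases hX : X₀ t q v' ψ = 0
  · rw [hX]; simp only [zero_mul]
  have hWm : Measurable fun q' : Cfg P k => pW Λ qU D M (gWg Λ D ek T) t q' v' ψ :=
    ((measurable_pW (Wg := gWg Λ D ek T) measurable_qU hMm measurable_gW t).comp (measurable_id.prodMk (measurable_const (a := (v', ψ)))) :)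
  have hWi : ∀ e : (D t).Ext, Integrable (fun i => pW Λ qU D M (gWg Λ D ek T) t ((D t).glue e i) v' ψ) ((D t).μInt m) := fun e =>
    BIJ88Eq5127ProductMeasure.integrable_pW_fibre hMs hMpd t v' ψ (fun q => hv t ht q v') (fun e i => gW_glue_gaugePart t e i)
      (fun e => integrable_gW_fibre hek t e) e
  have hch' := hch t ht q v' ψ hX
  obtain ⟨e, i, rfl⟩ : ∃ e i, q = (D t).glue e i := ⟨((D t).split q).1, ((D t).split q).2, ((D t).glue_split q).symm⟩
  simp only [Interior.split_glue] at hch' ⊢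
  rw [mul_assoc, normW_mul_integral_condW t hWm (fun q' => pW_pos (Wg := gWg Λ D ek T) (fun t q _ _ => gW_pos t q) t q' v' ψ) hWi,
    inner_integral_eq hek hr hT hK hMs hMpd hMm hc t e v' ψ (haOut t ht e) (fun q' => hv t ht q' v') (hidem t ht e) hch' (hBm t v' ψ)
      (fun i => hBretr t ht e i v' ψ) (fun q' => hBwin t ht q' v' ψ)]
  ring

/-- **ROW C2.Eq5.12.8 ON THE TORUS — THE GAUGE SECTOR BY NAME WITH `HChart` DISCHARGED** (measure `𝒟u δ_{Ax}`; `E = Et`, `R = Rtt`,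
`c = ct`): hypotheses are the numerics (`e_k > 0`, `r ≥ 0`, `ε > 0`, `2(d+1)L·e_k(r + ε) < π`), the standing range, the two fat-interior
compatibilities (p. 266), the bracket readings `hBretr`/`hBwin`/`hv`/`hX₀`/`hJ`, and **the support reading of the exterior bracket**: wherever
`X₀ t q v′ ψ ≠ 0` the exterior bond variables of `q` near the constrained block bonds satisfy `|(ie_k)⁻¹log| ≤ r + ε` (print: `X₀` carries the
small-field characteristic functions).  No measure-level hypothesis and no geometric reading is left (`haOut`, `hidem` of G1 are discharged by
`uCut_glue_fst_of_not_mem`, `uCut_gl_idem`). [cite: BalabanImbrieJaffe1988, (5.12.8) p.303] -/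
theorem eq5128_gauge_torus {terms : Finset ι} (hk : k + 1 ≤ P.m + P.K)
    {J : ι → Prev P k → GaugeField P k U1 → GaugeField P (k+1) U1 → HiggsField P k → HiggsField P (k+1) → ℂ}
    {ρL : GaugeField P (k+1) U1 → HiggsField P (k+1) → ℂ} {ε : ℝ}
    (h : IsDT (BIJ88RenormTransf311.axialMeasure P k U1) terms Λ qU J ρL)
    (hek : 0 < ek) (hr0 : 0 ≤ r) (hε : 0 < ε) (hnum : 2 * ((P.d : ℝ) + 1) * P.L * (ek * (r + ε)) < π)
    (hfat : ∀ t, ∀ b ∈ (D t).Ib, ∀ b', IsCross b → IsCross b' → coarse b' = coarse b → coarse b ∈ Λ t → b' ∈ (D t).Ib)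
    (hfat' : ∀ t, ∀ b', b' ∉ (D t).Ib → IsCross b' → coarse b' ∈ Λ t → ∀ b, Near (coarse b') b → b ∉ (D t).Ib)
    (hT : ∀ t, (T t).IsSymm) (hK : ∀ t, (precK (inIb (D t)) (T t) (Et Λ D t)).PosDef)
    (hMs : ∀ t v, (M t v).IsSymm) (hMpd : ∀ t v, (blkIn (inIx (D t)) (M t v)).PosDef) (hMm : ∀ t i j, Measurable fun v => M t v i j)
    (X₀ B₀ : ι → Cfg P k → GaugeField P (k+1) U1 → HiggsField P (k+1) → ℂ)
    (hv : ∀ t ∈ terms, ∀ (q : Cfg P k) (v' : GaugeField P (k+1) U1), vCut qU (Λ t) ((D t).freeze q).1 v' = vCut qU (Λ t) q.1 v')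
    (hX₀ : ∀ t ∈ terms, ∀ q v' ψ, X₀ t ((D t).freeze q) v' ψ = X₀ t q v' ψ)
    (hJ : ∀ t ∈ terms, ∀ q v' ψ, readEntry Λ qU J t q v' ψ =
      X₀ t q v' ψ * (gW Λ D ek T t q : ℂ) *
        (Real.exp (-(1 / 2 : ℝ) * (realCoords q.2.2 ⬝ᵥ (M t (vCut qU (Λ t) q.1 v') *ᵥ realCoords q.2.2))) : ℂ) * B₀ t q v' ψ)
    (hBm : ∀ t v' ψ, Measurable fun q => B₀ t q v' ψ)
    (hBretr : ∀ t ∈ terms, ∀ (e : (D t).Ext) (i : (D t).Int) v' ψ,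
      B₀ t ((D t).glue e i) v' ψ = B₀ t ((D t).glue e (retr Λ D t e i)) v' ψ)
    (hBwin : ∀ t ∈ terms, ∀ q v' ψ, B₀ t q v' ψ ≠ 0 → ∀ b, |aIn Λ D ek t q b| ≤ r)
    (hXsmall : ∀ t ∈ terms, ∀ q v' ψ, X₀ t q v' ψ ≠ 0 →
      ∀ c ∈ cset (D t) (Λ t), ∀ b (hb : b ∉ (D t).Ib), Near c b → |aOf ek (((D t).split q).1.1 ⟨b, hb⟩)| ≤ r + ε)
    (hJi : ∀ t ∈ terms, Integrable (termIntegrand Λ qU J t) (termMeasure (Measure.pi (axialLaw P k)))) :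
    IsDC terms Λ qU (fun t => (D t).extMeasure (axialLaw P k))
      (fun t q v' ψ => X₀ t q v' ψ * (sX Λ qU D M t q v' : ℂ) *
        (normPrint Λ D ek T M (Et Λ D) (Rtt Λ D) (ct Λ D ek hk hfat) t ((D t).split q).1 v' : ℂ))
      (fun t q v' _ => (D t).fibreMeasure (lawInt Λ D ek T M (Et Λ D) (Rtt Λ D) r t ((D t).split q).1 v') ((D t).split q).1) B₀ ρL := by
  have hsmall : ek * r < π := by
    have hL : (1 : ℝ) ≤ P.L := by exact_mod_cast P.L_pos
    have hd : (0 : ℝ) ≤ P.d := Nat.cast_nonneg _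
    have hK : (1 : ℝ) ≤ 2 * ((P.d : ℝ) + 1) * P.L := by nlinarith
    have h1 := mul_le_mul_of_nonneg_right hK (mul_nonneg hek.le (by linarith : (0 : ℝ) ≤ r + ε))
    rw [one_mul] at h1
    have h2 : ek * r ≤ ek * (r + ε) := mul_le_mul_of_nonneg_left (by linarith) hek.le
    exact h2.trans_lt (h1.trans_lt hnum)
  have haOut : ∀ t ∈ terms, ∀ (e : (D t).Ext) (i : (D t).Int), aOut Λ D ek t ((D t).glue e i) = aOut Λ D ek t ((D t).glue e (D t).base) :=
    fun t _ e i => funext fun b' => congrArg (aOf ek) (uCut_glue_fst_of_not_mem hk (hfat' t) e i b'.2)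
  have hidem : ∀ t ∈ terms, ∀ (e : (D t).Ext) (i₁ : (D t).IU), yInt Λ D t e (yInt Λ D t e i₁) = yInt Λ D t e i₁ :=
    fun t _ e i₁ => uCut_gl_idem hk (hfat t) e i₁
  exact eq5128_gauge_of_support (isDT_axial_iff.mp h) hek hsmall hT hK hMs hMpd hMm (ct_nonneg ek hk hfat hek) X₀ B₀ hv hX₀ hJ haOut hidem hBm
    hBretr hBwin (fun t ht q v' ψ hX => hChart ek hk hek hr0 hε hnum hfat t _ (hXsmall t ht q v' ψ hX)) hJi

end Main

/-! ## §5 Print's fat interior `X^{c*c}` of a union of blocks satisfies both compatibilities -/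

section Fat

/-- **THE FAT BOND SET `X^{c*c}` OF A UNION OF BLOCKS** (p. 266 *"X^{c*c} includes bonds with one or both endpoints in X"*): the unit bonds with
an endpoint in `⋃_{y∈S} B(y)` — the interior gauge bonds `Λ^{c*c}_{10}` of (5.12.3) for `Λ₁₀ = ⋃_{y∈S} B(y)`. [cite: BalabanImbrieJaffe1988, (3.5) p.266] -/
def fatBonds (S : Finset (Balaban1983to89.Site P (k+1))) : Finset (PBond P k) :=
  Finset.univ.filter fun b => blockOf b.src ∈ S ∨ blockOf b.tgt ∈ S

/-- kernel: membership in the fat bond set. [cite: BalabanImbrieJaffe1988, (3.5) p.266] -/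
theorem mem_fatBonds {S : Finset (Balaban1983to89.Site P (k+1))} {b : PBond P k} : b ∈ fatBonds S ↔ blockOf b.src ∈ S ∨ blockOf b.tgt ∈ S := by
  unfold fatBonds
  rw [Finset.mem_filter, and_iff_right (Finset.mem_univ _)]

/-- **FIRST FAT-INTERIOR COMPATIBILITY** (hypothesis `hfat`): all surface bonds of the block bond of an interior surface bond are interior
(standing range). [cite: BalabanImbrieJaffe1988, (3.5) p.266] -/
theorem fatBonds_compat (hk : k + 1 ≤ P.m + P.K) (S : Finset (Balaban1983to89.Site P (k+1))) (Λ₀ : Finset (PBond P (k+1))) :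
    ∀ b ∈ fatBonds S, ∀ b', IsCross b → IsCross b' → coarse b' = coarse b → coarse b ∈ Λ₀ → b' ∈ fatBonds S := by
  intro b hb b' hc hc' he _
  have hsrc : blockOf b'.src = blockOf b.src := (congrArg PBond.src he :)
  have hdir : b'.dir = b.dir := (congrArg PBond.dir he :)
  rw [mem_fatBonds, blockOf_tgt_of_isCross hk hc] at hb
  rw [mem_fatBonds, blockOf_tgt_of_isCross hk hc', hsrc, hdir]
  exact hb

/-- **SECOND FAT-INTERIOR COMPATIBILITY** (hypothesis `hfat'`): the block bond of an exterior surface bond sees no interior bond (standing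
range). [cite: BalabanImbrieJaffe1988, (3.5) p.266] -/
theorem fatBonds_compat' (hk : k + 1 ≤ P.m + P.K) (S : Finset (Balaban1983to89.Site P (k+1))) (Λ₀ : Finset (PBond P (k+1))) :
    ∀ b', b' ∉ fatBonds S → IsCross b' → coarse b' ∈ Λ₀ → ∀ b, Near (coarse b') b → b ∉ fatBonds S := by
  intro b' hb' hc' _ b hn hb
  rw [mem_fatBonds, blockOf_tgt_of_isCross hk hc', not_or] at hb'
  have hsrc : blockOf b.src ∉ S := by
    rcases hn.1 with h | h
    · rw [h]; exact hb'.1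
    · rw [h]; exact hb'.2
  rw [mem_fatBonds] at hb
  rcases hb with h | h
  · exact hsrc h
  · by_cases hc : IsCross b
    · have he := hn.2 hc
      have h1 : blockOf b.src = blockOf b'.src := (congrArg PBond.src he :)
      have h2 : b.dir = b'.dir := (congrArg PBond.dir he :)
      rw [blockOf_tgt_of_isCross hk hc, h1, h2] at h
      exact hb'.2 h
    · rw [blockOf_tgt_of_not_isCross hk hc] at h
      exact hsrc h

end Fat

/-! ## §6 (v1.1) The locality reading `hv` for print's fat interior: every hypothesis on the regions discharged -/

section Nest

open BIJ85BlockAveragesTorus (corner blockOf_corner runSite blockOf_runSite_L mem_block_iff runBond legBond)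
open BIJ88ContourSupport536 (near_legBond near_runBond)
open BIJ88Eq5128Locality (qUSupport runBonds holBonds vCut_freeze_eq_qU)

/-- **EVERY BOND ENTERING `(Qu)_c` IS NEAR `c`** (gen 11's exact support `qUSupport` of (2.10) lies in this seat's `Near c`; standing range).
[cite: BalabanImbrieJaffe1985, (2.10) p.303] -/
theorem near_of_mem_qUSupport (hk : k + 1 ≤ P.m + P.K) {c : PBond P (k+1)} {b : PBond P k} (hb : b ∈ qUSupport c) : Near c b := by
  unfold qUSupport at hb
  rcases Finset.mem_union.1 hb with h | h
  · obtain ⟨t, ht, rfl⟩ := Finset.mem_image.1 h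
    exact near_runBond hk (blockOf_corner hk c.src) (Finset.mem_range.1 ht)
  · obtain ⟨x, hx, hbx⟩ := Finset.mem_biUnion.1 h
    have hy : blockOf x = c.src := mem_block_iff.1 hx
    rcases Finset.mem_union.1 hbx with h₁ | h₁
    · rcases Finset.mem_union.1 h₁ with h₂ | h₂
      · obtain ⟨μ, -, hμ⟩ := Finset.mem_biUnion.1 h₂
        obtain ⟨t, ht, rfl⟩ := Finset.mem_image.1 hμ
        exact near_legBond hk (Or.inl hy) (Finset.mem_range.1 ht)
      · obtain ⟨t, ht, rfl⟩ := Finset.mem_image.1 h₂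
        exact near_runBond hk hy (Finset.mem_range.1 ht)
    · obtain ⟨μ, -, hμ⟩ := Finset.mem_biUnion.1 h₁
      obtain ⟨t, ht, rfl⟩ := Finset.mem_image.1 hμ
      have hy' : blockOf (runSite x c.dir P.L) = c.src.shift c.dir := by rw [blockOf_runSite_L hk, hy]
      exact near_legBond hk (Or.inr hy') (Finset.mem_range.1 ht)

/-- **THE NESTING OF PRINT'S REGIONS GIVES `hIb`**: if every block bond touching a block of `S` is in the cut-off (print: `Λ^{(k)}_{10} ⊂ Λ^{(k)}_1`
by the p. 300 chain of collars, the cut-off being `Λ^{(k)′*}_1`), then no bond entering `(Qu)_c`, `c` off the cut-off, is a fat interior bond.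
[cite: BalabanImbrieJaffe1988, (5.12.8) p.303] -/
theorem fatBonds_hIb (hk : k + 1 ≤ P.m + P.K) (S : Finset (Balaban1983to89.Site P (k+1))) (Λ₀ : Finset (PBond P (k+1)))
    (hnest : ∀ c : PBond P (k+1), (c.src ∈ S ∨ c.src.shift c.dir ∈ S) → c ∈ Λ₀) :
    ∀ c, c ∉ Λ₀ → ∀ b ∈ qUSupport c, b ∉ fatBonds S := by
  intro c hc b hb hbS
  have hn := near_of_mem_qUSupport hk hb
  refine hc (hnest c ?_)
  rw [mem_fatBonds] at hbS
  rcases hbS with h | h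
  · rcases hn.1 with e | e
    · exact Or.inl (e ▸ h)
    · exact Or.inr (e ▸ h)
  · by_cases hcr : IsCross b
    · have he := hn.2 hcr
      have h1 : blockOf b.src = c.src := (congrArg PBond.src he :)
      have h2 : b.dir = c.dir := (congrArg PBond.dir he :)
      rw [blockOf_tgt_of_isCross hk hcr, h1, h2] at h
      exact Or.inr h
    · rw [blockOf_tgt_of_not_isCross hk hcr] at h
      rcases hn.1 with e | e
      · exact Or.inl (e ▸ h)
      · exact Or.inr (e ▸ h)

variable {ι : Type*} {Λ : ι → Finset (PBond P (k+1))} {D : ι → Interior P k}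

/-- kernel: the first fat-interior compatibility for a family of fat interiors. [cite: BalabanImbrieJaffe1988, (3.5) p.266] -/
theorem hfat_of_eq_fatBonds (hk : k + 1 ≤ P.m + P.K) {S : ι → Finset (Balaban1983to89.Site P (k+1))} (hD : ∀ t, (D t).Ib = fatBonds (S t)) :
    ∀ t, ∀ b ∈ (D t).Ib, ∀ b', IsCross b → IsCross b' → coarse b' = coarse b → coarse b ∈ Λ t → b' ∈ (D t).Ib := fun t => by
  rw [hD t]; exact fatBonds_compat hk (S t) (Λ t)

/-- kernel: the second fat-interior compatibility for a family of fat interiors. [cite: BalabanImbrieJaffe1988, (3.5) p.266] -/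
theorem hfat'_of_eq_fatBonds (hk : k + 1 ≤ P.m + P.K) {S : ι → Finset (Balaban1983to89.Site P (k+1))} (hD : ∀ t, (D t).Ib = fatBonds (S t)) :
    ∀ t, ∀ b', b' ∉ (D t).Ib → IsCross b' → coarse b' ∈ Λ t → ∀ b, Near (coarse b') b → b ∉ (D t).Ib := fun t => by
  rw [hD t]; exact fatBonds_compat' hk (S t) (Λ t)

variable {ek : ℝ} {T : ι → Matrix (PBond P k) (PBond P k) ℝ} {M : ι → GaugeField P (k+1) U1 → Matrix (RIdx P k) (RIdx P k) ℝ} {r : ℝ}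

/-- **ROW C2.Eq5.12.8 ON THE TORUS FOR PRINT'S REGIONS** — `eq5128_gauge_torus` with the interior gauge bonds `Λ^{(k)c*c}_{10} = fatBonds (S t)`
(p. 266) and the cut-off nesting `hnest` (`Λ₁₀`'s blocks touch only cut-off block bonds): the fat-interior compatibilities AND the locality
reading `hv` are discharged (gen 11's `BIJ88Eq5128Locality.vCut_freeze_eq_qU`).  Hypotheses left: the numerics, the bracket readings
`hX₀`/`hJ`/`hBm`/`hBretr`/`hBwin`, the support reading `hXsmall` (here on the raw exterior variables `q.1 b` of the configuration),
integrability. [cite: BalabanImbrieJaffe1988, (5.12.8) p.303] -/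
theorem eq5128_gauge_fat {terms : Finset ι} (hk : k + 1 ≤ P.m + P.K)
    {J : ι → Prev P k → GaugeField P k U1 → GaugeField P (k+1) U1 → HiggsField P k → HiggsField P (k+1) → ℂ}
    {ρL : GaugeField P (k+1) U1 → HiggsField P (k+1) → ℂ} {ε : ℝ} {S : ι → Finset (Balaban1983to89.Site P (k+1))}
    (h : IsDT (BIJ88RenormTransf311.axialMeasure P k U1) terms Λ qU J ρL)
    (hD : ∀ t, (D t).Ib = fatBonds (S t)) (hnest : ∀ t, ∀ c : PBond P (k+1), (c.src ∈ S t ∨ c.src.shift c.dir ∈ S t) → c ∈ Λ t)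
    (hek : 0 < ek) (hr0 : 0 ≤ r) (hε : 0 < ε) (hnum : 2 * ((P.d : ℝ) + 1) * P.L * (ek * (r + ε)) < π)
    (hT : ∀ t, (T t).IsSymm) (hK : ∀ t, (precK (inIb (D t)) (T t) (Et Λ D t)).PosDef)
    (hMs : ∀ t v, (M t v).IsSymm) (hMpd : ∀ t v, (blkIn (inIx (D t)) (M t v)).PosDef) (hMm : ∀ t i j, Measurable fun v => M t v i j)
    (X₀ B₀ : ι → Cfg P k → GaugeField P (k+1) U1 → HiggsField P (k+1) → ℂ)
    (hX₀ : ∀ t ∈ terms, ∀ q v' ψ, X₀ t ((D t).freeze q) v' ψ = X₀ t q v' ψ)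
    (hJ : ∀ t ∈ terms, ∀ q v' ψ, readEntry Λ qU J t q v' ψ =
      X₀ t q v' ψ * (gW Λ D ek T t q : ℂ) *
        (Real.exp (-(1 / 2 : ℝ) * (realCoords q.2.2 ⬝ᵥ (M t (vCut qU (Λ t) q.1 v') *ᵥ realCoords q.2.2))) : ℂ) * B₀ t q v' ψ)
    (hBm : ∀ t v' ψ, Measurable fun q => B₀ t q v' ψ)
    (hBretr : ∀ t ∈ terms, ∀ (e : (D t).Ext) (i : (D t).Int) v' ψ,
      B₀ t ((D t).glue e i) v' ψ = B₀ t ((D t).glue e (retr Λ D t e i)) v' ψ)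
    (hBwin : ∀ t ∈ terms, ∀ q v' ψ, B₀ t q v' ψ ≠ 0 → ∀ b, |aIn Λ D ek t q b| ≤ r)
    (hXsmall : ∀ t ∈ terms, ∀ q v' ψ, X₀ t q v' ψ ≠ 0 →
      ∀ c ∈ cset (D t) (Λ t), ∀ b, b ∉ (D t).Ib → Near c b → |aOf ek (q.1 b)| ≤ r + ε)
    (hJi : ∀ t ∈ terms, Integrable (termIntegrand Λ qU J t) (termMeasure (Measure.pi (axialLaw P k)))) :
    IsDC terms Λ qU (fun t => (D t).extMeasure (axialLaw P k))
      (fun t q v' ψ => X₀ t q v' ψ * (sX Λ qU D M t q v' : ℂ) *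
        (normPrint Λ D ek T M (Et Λ D) (Rtt Λ D) (ct Λ D ek hk (hfat_of_eq_fatBonds hk hD)) t ((D t).split q).1 v' : ℂ))
      (fun t q v' _ => (D t).fibreMeasure (lawInt Λ D ek T M (Et Λ D) (Rtt Λ D) r t ((D t).split q).1 v') ((D t).split q).1) B₀ ρL :=
  eq5128_gauge_torus hk h hek hr0 hε hnum (hfat_of_eq_fatBonds hk hD) (hfat'_of_eq_fatBonds hk hD) hT hK hMs hMpd hMm X₀ B₀
    (fun t _ q v' => vCut_freeze_eq_qU (D t) (Λ t) (by rw [hD t]; exact fatBonds_hIb hk (S t) (Λ t) (hnest t)) q v')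
    hX₀ hJ hBm hBretr hBwin (fun t ht q v' ψ hX c hc b hb hn => hXsmall t ht q v' ψ hX c hc b hb hn) hJi

end Nest

end

end Literature.MathematicalPhysics.QuantumFieldTheory.BalabanImbrieJaffe1984to88.BIJ88InteriorChartLaw
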